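import Literature.MathematicalPhysics.QuantumManyBody.BoseGasSubcellCondensationSharp
import Summits.AtomisticToContinuum.BoseEinsteinCondensation.Theorems.BlockLatticeFSumBlockCondensationCellNKeyInequality

/-!
# `BlockCondensation` (stmt-AtomisticToContinuum-13595) — P1, module A: the four carrier-dependent slice / bookkeeping lemmas of
# `BoseGasSubcellCondensation.lean` RE-TYPED on the cellN carrier (decomp-a2c, hand-2 g8; lens-6 g28 `CARRIER-CHANGE-13595-P1.md` §2 A1, A2, C1, C2)

The carrier of the `BlockCondensation` leaf is a `C¹`, Bose-symmetric `ψ : Config N → ℂ` NORMALISED ON THE FUNDAMENTAL CELL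
`cellN N L = [0,L)^{3N}` (no boundary condition), with the plain cell energy and the occupations of `1_{cellN} ψ`.  The tree's
`BoseGasSubcellCondensation.lean` proves the corresponding facts for Dirichlet states `Ψ : TrialState N L` (support in the open box), using
`Ψ.eq_zero` at exactly the three spots D1–D3 of the memo.  Here:

* `sum_lintegral_subcellMeanSq_cellN` (A1) : `∑ᵢ L⁻³ ∫_{Ω^N} s⁻³ |∫_{Q_q} ψ(…, xᵢ = x, …) dx|² dX = ⟨u_q, γ_{1_{cellN}ψ} u_q⟩` — D1 replaced by
  `occupation_subMode_indicator` (the spectator variables of the cell-restricted state run over the cell);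
* `occupation_add_depletion_eq_cellN` (A2) : the sub-cell depletion identity `∑_q ⟨u_q, γ u_q⟩ + depletion = N`, D2 replaced by the
  normalisation hypothesis on `cellN`;
* `sum_sum_groupEnergy_le_energy_cellN` (C1) : `∑_σ ∑_c ∫_{cellSet σ}(T_c + I_c|ψ|²) ≤ ∫_{cellN}(|∇ψ|² + Σv|ψ|²)` (the cell sets lie in the
  fundamental cell);
* `sum_mass_cellSet_eq_one_cellN` (C2) : `∑_σ ∫_{cellSet σ}|ψ|² = 1`, D3 replaced by the exact half-open partition of `cellN`.

Everything else in the memo's list is generic in `ψ` and imported.  `[folklore]` / [LSSY2005, (5.15)–(5.17)]; no definitions, no `sorry`.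
-/

noncomputable section

open MeasureTheory Filter Set Metric
open scoped ENNReal NNReal Topology BigOperators

namespace Summit.AtomisticToContinuum.BoseEinsteinCondensation.Theorems.BlockLatticeFSumBlockCondensationCellNTransportSlices

open Literature.MathematicalPhysics.QuantumManyBody.BoseGas
open Summit.AtomisticToContinuum.BoseEinsteinCondensation.Theorems.BlockLatticeFSumBlockCondensationCellNKeyInequality
  (occupation_subMode_indicator)

variable {N n K : ℕ} {s L : ℝ}

/-- **A1.** The sub-cell mean terms summed over the particles give the occupation of the sub-cell mode IN THE CELL-RESTRICTED STATE:
`∑ᵢ L⁻³ ∫_{Ω^N} s⁻³ |∫_{Q_q} ψ(…, xᵢ = x, …) dx|² dX = ⟨u_q, γ_{1_{cellN} ψ} u_q⟩` for a Bose-symmetric continuous `ψ`, `L = Ks`.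
[cite: LSSY2005, §1.2 (1.17); folklore (carrier form)] -/
theorem sum_lintegral_subcellMeanSq_cellN (hs : 0 < s) (hL : 0 < L) (hKs : (K : ℝ) * s = L) (q : SubIdx K)
    {ψ : Config (n + 1) → ℂ} (hcont : Continuous ψ)
    (hsymm : ∀ (σ : Equiv.Perm (Fin (n + 1))) (X : Config (n + 1)), ψ (X ∘ σ) = ψ X) :
    ∑ i : Fin (n + 1), (ENNReal.ofReal L ^ 3)⁻¹ *
        ∫⁻ X in cellN (n + 1) L, (ENNReal.ofReal s ^ 3)⁻¹ *
          (‖∫ x in subCell s q, ψ (Function.update X i x)‖₊ : ℝ≥0∞) ^ 2 =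
      occupation (n + 1) (subMode s q) ((cellN (n + 1) L).indicator ψ) := by
  have hL3 : ENNReal.ofReal L ^ 3 ≠ 0 := pow_ne_zero _ (by simpa using hL)
  have hL3' : ENNReal.ofReal L ^ 3 ≠ ⊤ := ENNReal.pow_ne_top ENNReal.ofReal_ne_top
  have hs3' : (ENNReal.ofReal s ^ 3)⁻¹ ≠ ⊤ :=
    ENNReal.inv_ne_top.2 (pow_ne_zero _ (by simpa using hs))
  have hterm : ∀ i : Fin (n + 1),
      (ENNReal.ofReal L ^ 3)⁻¹ *
          ∫⁻ X in cellN (n + 1) L, (ENNReal.ofReal s ^ 3)⁻¹ *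
            (‖∫ x in subCell s q, ψ (Function.update X i x)‖₊ : ℝ≥0∞) ^ 2 =
        (ENNReal.ofReal s ^ 3)⁻¹ *
          ∫⁻ Y in cellN n L, (‖∫ x in subCell s q, ψ (Matrix.vecCons x Y)‖₊ : ℝ≥0∞) ^ 2 := by
    intro i
    rw [lintegral_const_mul' _ _ hs3']
    have h1 : (fun X => (‖∫ x in subCell s q, ψ (Function.update X i x)‖₊ : ℝ≥0∞) ^ 2) =
        fun X => (‖∫ x in subCell s q,
          ψ (Function.update (X ∘ Equiv.swap 0 i) 0 x)‖₊ : ℝ≥0∞) ^ 2 :=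
      funext fun X => subcellMeanSq_eq_zero_comp_swap _ i hsymm X
    rw [h1, lintegral_cellN_comp_perm (Equiv.swap 0 i)
        (fun X => (‖∫ x in subCell s q, ψ (Function.update X 0 x)‖₊ : ℝ≥0∞) ^ 2),
      lintegral_subcellMeanSq_zero L _ hcont, ← mul_assoc, ← mul_assoc,
      mul_comm (ENNReal.ofReal L ^ 3)⁻¹, mul_assoc _ _ (ENNReal.ofReal L ^ 3),
      ENNReal.inv_mul_cancel hL3 hL3', mul_one]
  simp only [hterm, Finset.sum_const, Finset.card_univ, Fintype.card_fin, nsmul_eq_mul]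
  rw [occupation_subMode_indicator hs hKs q ψ, lintegral_const_mul' _ _ hs3']
  push_cast
  ring

/-- **A2. The sub-cell depletion identity on the cellN carrier** (LSSY (5.17) per sub-cell, symmetrised): for a `C¹` Bose-symmetric `ψ`
normalised on `cellN (n+1) L`, `L = Ks`,
`∑_q ⟨u_q, γ_{1_{cellN}ψ} u_q⟩ + ∑ᵢ L⁻³ ∫_{Ω^N} ∑_q ∫_{Q_q} |ψ(…,xᵢ = x,…) − ⟨ψ(…,xᵢ = ·,…)⟩_{Q_q}|² dx dX = N`.
[cite: LSSY2005, (5.17); folklore (carrier form)] -/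
theorem occupation_add_depletion_eq_cellN (hs : 0 < s) (hL : 0 < L) (hKs : (K : ℝ) * s = L)
    {ψ : Config (n + 1) → ℂ} (hψ : ContDiff ℝ 1 ψ)
    (hsymm : ∀ (σ : Equiv.Perm (Fin (n + 1))) (X : Config (n + 1)), ψ (X ∘ σ) = ψ X)
    (hnorm : ∫⁻ X in cellN (n + 1) L, (‖ψ X‖₊ : ℝ≥0∞) ^ 2 = 1) :
    (∑ q : SubIdx K, occupation (n + 1) (subMode s q) ((cellN (n + 1) L).indicator ψ)) +
      ∑ i : Fin (n + 1), (ENNReal.ofReal L ^ 3)⁻¹ * ∫⁻ X in cellN (n + 1) L,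
        ∑ q : SubIdx K, ∫⁻ x in subCell s q,
          (‖ψ (Function.update X i x) -
            ⨍ y in subCell s q, ψ (Function.update X i y)‖₊ : ℝ≥0∞) ^ 2 =
      ((n + 1 : ℕ) : ℝ≥0∞) := by
  have hL3 : ENNReal.ofReal L ^ 3 ≠ 0 := pow_ne_zero _ (by simpa using hL)
  have hL3' : ENNReal.ofReal L ^ 3 ≠ ⊤ := ENNReal.pow_ne_top ENNReal.ofReal_ne_top
  have hcont : Continuous ψ := hψ.continuous
  have hone : ∀ i : Fin (n + 1), (ENNReal.ofReal L ^ 3)⁻¹ *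
      ∫⁻ X in cellN (n + 1) L, ∫⁻ x in cell L,
        (‖ψ (Function.update X i x)‖₊ : ℝ≥0∞) ^ 2 = 1 := by
    intro i
    rw [lintegral_normSq_slice i hcont.measurable, hnorm, mul_one,
      ENNReal.inv_mul_cancel hL3 hL3']
  have hsplit : ∀ (i : Fin (n + 1)) (X : Config (n + 1)),
      ∫⁻ x in cell L, (‖ψ (Function.update X i x)‖₊ : ℝ≥0∞) ^ 2 =
        (∑ q : SubIdx K, ∫⁻ x in subCell s q,
          (‖ψ (Function.update X i x) -
            ⨍ y in subCell s q, ψ (Function.update X i y)‖₊ : ℝ≥0∞) ^ 2) +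
        ∑ q : SubIdx K, (ENNReal.ofReal s ^ 3)⁻¹ *
          (‖∫ x in subCell s q, ψ (Function.update X i x)‖₊ : ℝ≥0∞) ^ 2 := by
    intro i X
    have hc : Continuous fun x => ψ (Function.update X i x) :=
      hcont.comp (continuous_const.update i continuous_id)
    have hpart := sum_setLIntegral_subCell (k := K) hs
      (hc.measurable.nnnorm.coe_nnreal_ennreal.pow_const 2).aemeasurable
    rw [hKs] at hpart
    rw [← hpart, ← Finset.sum_add_distrib]
    refine Finset.sum_congr rfl fun q _ => ?_
    exact lintegral_nnnorm_sq_cellShift_eq hs hc (subOffset s q)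
  have hN : ((n + 1 : ℕ) : ℝ≥0∞) = ∑ i : Fin (n + 1), (ENNReal.ofReal L ^ 3)⁻¹ *
      ∫⁻ X in cellN (n + 1) L, ∫⁻ x in cell L,
        (‖ψ (Function.update X i x)‖₊ : ℝ≥0∞) ^ 2 := by
    simp only [hone, Finset.sum_const, Finset.card_univ, Fintype.card_fin, nsmul_eq_mul,
      mul_one]
  have hmeas : ∀ i : Fin (n + 1), Measurable fun X : Config (n + 1) =>
      ∑ q : SubIdx K, (ENNReal.ofReal s ^ 3)⁻¹ *
        (‖∫ x in subCell s q, ψ (Function.update X i x)‖₊ : ℝ≥0∞) ^ 2 := fun i =>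
    Finset.measurable_sum _ fun q _ => (measurable_subcellMeanSq _ i hcont).const_mul _
  have hocc : ∑ i : Fin (n + 1), (ENNReal.ofReal L ^ 3)⁻¹ * ∫⁻ X in cellN (n + 1) L,
      ∑ q : SubIdx K, (ENNReal.ofReal s ^ 3)⁻¹ *
        (‖∫ x in subCell s q, ψ (Function.update X i x)‖₊ : ℝ≥0∞) ^ 2 =
      ∑ q : SubIdx K, occupation (n + 1) (subMode s q) ((cellN (n + 1) L).indicator ψ) := by
    have : ∀ i : Fin (n + 1), (ENNReal.ofReal L ^ 3)⁻¹ * ∫⁻ X in cellN (n + 1) L,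
        ∑ q : SubIdx K, (ENNReal.ofReal s ^ 3)⁻¹ *
          (‖∫ x in subCell s q, ψ (Function.update X i x)‖₊ : ℝ≥0∞) ^ 2 =
        ∑ q : SubIdx K, (ENNReal.ofReal L ^ 3)⁻¹ * ∫⁻ X in cellN (n + 1) L,
          (ENNReal.ofReal s ^ 3)⁻¹ *
            (‖∫ x in subCell s q, ψ (Function.update X i x)‖₊ : ℝ≥0∞) ^ 2 := by
      intro i
      rw [lintegral_finsetSum _ fun q _ => (measurable_subcellMeanSq _ i hcont).const_mul _,
        Finset.mul_sum]
    simp only [this]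
    rw [Finset.sum_comm]
    exact Finset.sum_congr rfl fun q _ => sum_lintegral_subcellMeanSq_cellN hs hL hKs q hcont hsymm
  rw [hN, ← hocc, add_comm, ← Finset.sum_add_distrib]
  refine Finset.sum_congr rfl fun i _ => ?_
  rw [← mul_add, ← lintegral_add_right' _ (hmeas i).aemeasurable]
  congr 1
  refine lintegral_congr fun X => ?_
  rw [hsplit i X]

/-- **C1. The groups' energies add up to at most the CELL energy**: for a `C¹` function `ψ`, `L = Ks`,
`∑_σ ∑_c ∫_{cellSet σ} (T_c + I_c |ψ|²) ≤ ∫_{cellN}(|∇ψ|² + Σ_{i<j}v |ψ|²)` — the cell sets are disjoint subsets of the fundamental cell.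
[cite: LSSY2005, Lemma 5.2 (5.7)–(5.14); folklore (carrier form)] -/
theorem sum_sum_groupEnergy_le_energy_cellN (hs : 0 < s) (hKs : (K : ℝ) * s = L)
    {v : ℝ → ℝ≥0∞} (hv : Measurable v) {ψ : Config N → ℂ} (hψ : ContDiff ℝ 1 ψ) :
    ∑ σ : Fin N → Fin (K ^ 3), ∑ c : Fin (K ^ 3), ∫⁻ X in cellSet K s σ,
        kineticOn ((Finset.univ.filter fun i => σ i = c).orderEmbOfFin rfl) ψ X +
          interactionOn ((Finset.univ.filter fun i => σ i = c).orderEmbOfFin rfl) v X *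
            (‖ψ X‖₊ : ℝ≥0∞) ^ 2 ≤
      ∫⁻ X in cellN N L, kineticDensity ψ X + interaction v X * (‖ψ X‖₊ : ℝ≥0∞) ^ 2 := by
  have hF : ∀ (σ : Fin N → Fin (K ^ 3)) (c : Fin (K ^ 3)), Measurable fun X =>
      kineticOn ((Finset.univ.filter fun i => σ i = c).orderEmbOfFin rfl) ψ X +
        interactionOn ((Finset.univ.filter fun i => σ i = c).orderEmbOfFin rfl) v X *
          (‖ψ X‖₊ : ℝ≥0∞) ^ 2 := fun σ c =>
    (measurable_kineticOn _ hψ).add ((measurable_interactionOn _ hv).mul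
      (measurable_normSq hψ.continuous))
  have hsub : (⋃ σ : Fin N → Fin (K ^ 3), cellSet K s σ) ⊆ cellN N L := by
    refine Set.iUnion_subset fun σ => ?_
    rw [← hKs]
    exact (cellSet_subset_hcellSet K s σ).trans (hcellSet_subset_cellN hs σ)
  calc _ ≤ ∑ σ : Fin N → Fin (K ^ 3), ∫⁻ X in cellSet K s σ,
          kineticDensity ψ X + interaction v X * (‖ψ X‖₊ : ℝ≥0∞) ^ 2 := by
        refine Finset.sum_le_sum fun σ _ => ?_
        rw [← lintegral_finsetSum _ fun c _ => hF σ c]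
        refine lintegral_mono fun X => ?_
        rw [Finset.sum_add_distrib, ← Finset.sum_mul, ← kineticDensity_eq_sum_kineticOn σ ψ X]
        gcongr
        exact sum_interactionOn_le_interaction σ v X
    _ = ∫⁻ X in ⋃ σ : Fin N → Fin (K ^ 3), cellSet K s σ,
          kineticDensity ψ X + interaction v X * (‖ψ X‖₊ : ℝ≥0∞) ^ 2 := by
        rw [lintegral_iUnion (fun σ => measurableSet_cellSet K s σ) (pairwiseDisjoint_cellSet hs),
          tsum_fintype]
    _ ≤ _ := lintegral_mono_set hsub

/-- **C2. The masses of the cell sets add up to one** for a function normalised on `cellN N L`, `L = Ks` (the half-open cell sets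
partition the fundamental cell exactly and agree a.e. with the open ones). [folklore] -/
theorem sum_mass_cellSet_eq_one_cellN (hs : 0 < s) (hK : 0 < K) (hKs : (K : ℝ) * s = L)
    {ψ : Config N → ℂ} (hnorm : ∫⁻ X in cellN N L, (‖ψ X‖₊ : ℝ≥0∞) ^ 2 = 1) :
    ∑ σ : Fin N → Fin (K ^ 3), ∫⁻ X in cellSet K s σ, (‖ψ X‖₊ : ℝ≥0∞) ^ 2 = 1 := by
  calc ∑ σ : Fin N → Fin (K ^ 3), ∫⁻ X in cellSet K s σ, (‖ψ X‖₊ : ℝ≥0∞) ^ 2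
      = ∑ σ : Fin N → Fin (K ^ 3),
          ∫⁻ X in {X : Config N | ∀ j, X j ∈ subCell s (cellCoord K (σ j))}, (‖ψ X‖₊ : ℝ≥0∞) ^ 2 :=
        Finset.sum_congr rfl fun σ _ => (setLIntegral_hcellSet_eq_cellSet hs hK σ _).symm
    _ = ∫⁻ X in ⋃ σ : Fin N → Fin (K ^ 3), {X : Config N | ∀ j, X j ∈ subCell s (cellCoord K (σ j))},
          (‖ψ X‖₊ : ℝ≥0∞) ^ 2 := by
        rw [lintegral_iUnion (fun σ => measurableSet_hcellSet K s σ) (pairwiseDisjoint_hcellSet hs),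
          tsum_fintype]
    _ = ∫⁻ X in cellN N L, (‖ψ X‖₊ : ℝ≥0∞) ^ 2 := by rw [iUnion_hcellSet_eq_cellN hs, hKs]
    _ = 1 := hnorm

end Summit.AtomisticToContinuum.BoseEinsteinCondensation.Theorems.BlockLatticeFSumBlockCondensationCellNTransportSlices

end
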